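import Summits.ValiantsHypothesis.ValiantsHypothesis.Theorems.KPlusLogSqLawTropicalBirkhoffFacePotential
import Summits.ValiantsHypothesis.ValiantsHypothesis.Theorems.KPlusLogSqLawTropicalPageRigidityMatchingK

/-!
# Route «KPlusLogSqLaw», crux `WeakLifting` (stmt-ValiantsHypothesis-19561), docket D2 — GRADED PAGES: in the lex regime of one class,
# the top-class indicator on the union support of same-count dominant terms is an INTEGER ROW + COLUMN POTENTIAL

HONEST FRAMING.  Helper file (cell `pub-symmetroid`, seat val-sym-lift-p3 g25, 2026-08-29) `--supports` the crux
`Summit.ValiantsHypothesis.ValiantsHypothesis.Theses.KPlusLogSqLaw.WeakLifting` (ledger item `stmt-ValiantsHypothesis-19561`, route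
`KPlusLogSqLaw`; lineage docket D2 = the `K = 4` tropical exponent fork `TropicalCensus.TropK4Law 2` vs a cubic family).  It is the kernel
form of requirement R3 «page rigidity ⇒ GRADED PAGES» of the lineage memo HOME/val-sym-lift-p3/g4/K4-PAGE-RIGIDITY-AND-CARRIES.md §3–4,
obtained from the tree's LEX TOP-CLASS RIGIDITY in perfect-matching form (`TropicalCensus.classCount_eq_of_recombination`, p494347) and the
BIRKHOFF-FACE POTENTIAL LEMMA (`BirkhoffFace.exists_potential_of_sum_const`, companion file).  A STRUCTURE law for dominant terms of an
ARBITRARY design in the lex regime of one class; it decides nothing about the fork and asserts nothing about `WeakLifting`, `TropicalB`,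
`Lifting`, `KPlusLogSqLaw`, `MatrixDescartes` (stmt-ValiantsHypothesis-18050) or VP ≠ VNP.

SETTING (as in `classCount_eq_of_recombination`).  A design `(d, v, ε)` of format `(m, K)`, a class `l⋆` whose exponent dominates:
`d l ≤ D` for `l ≠ l⋆` and `(k/2)·m·D ≤ d l⋆`; terms `t₀, …, t_{k−1}` (`k ≥ 1`) dominant (`IsDominant`) at strictly increasing slopes, all with
the same number `c` of `l⋆`-entries — e.g. the terms of one PAGE of a strongly lex design (`k ≤ m` allowed when `d l⋆ ≥ (m/2)·m·D`).  The
UNION SUPPORT of the page is the set of positions `((t r).1 i, i)`.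

* `top_iff_of_same_position` — TOP-NESS IS A PROPERTY OF THE POSITION: two page terms through the same position agree on whether their class
  there is `l⋆` (swap the single column between the two terms: a recombination with the same rows, so both counts are `c`).
* `exists_grading` — **GRADED PAGES**: there are integer potentials `α β : Fin m → ℤ` with
  `[ (t r).2 i = l⋆ ] = α ((t r).1 i) + β i` for every page term `t r` and every column `i`.  (The `l⋆`-indicator of positions is constant
  (`= c`) on every permutation supported in the union support — `classCount_eq_of_recombination` with a column-wise choice of terms — so the
  Birkhoff-face lemma applies.)
* `grading_mem_zero_one` — on the union support the grading takes only the values `0, 1`; `card_top_eq_sum_grading` — every permutation `σ`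
  supported in the union support has exactly `Σ_i (α (σ i) + β i) = Σ α + Σ β` top positions (the page count, re-derived through the grading).

READING (located in the memo, now kernel): inside one strongly-lex page the top class rides on an integer ROW/COLUMN GRADING of the page's union
support — support only where `α_a + β_i ∈ {0, 1}`, top entries exactly on the level `α_a + β_i = 1` (two-level case = «dedicated lines»); in
particular every cycle inside the union support preserves the top count by telescoping.  What this file does NOT do: the analogous statement for
class `2` inside one ROW needs the two-step Abel argument of the memo (top rigidity first) and is not derived here; no bound on any tropical row.
[folklore: LP duality on a face of the Birkhoff polytope; the packaging is the cell's]
-/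

set_option linter.dupNamespace false
set_option autoImplicit false

namespace Summit.ValiantsHypothesis.ValiantsHypothesis.Theorems.KPlusLogSqLaw

open Summit.ValiantsHypothesis.ValiantsHypothesis.Theorems.MatrixDescartes.Negative
open Summit.ValiantsHypothesis.ValiantsHypothesis.Theorems.LacunarySymmetroidMatrixDescartes.TropicalCensus
open scoped BigOperators
open Finset

namespace GradedPages

variable {m K : ℕ}

/-- **Top-ness is a property of the position.**  Under the hypotheses of `classCount_eq_of_recombination`, two page terms that use the same
position in column `i` agree on whether the class there is `l⋆`. -/
theorem top_iff_of_same_position {k : ℕ} (d : Fin K → ℕ) (v ε : Fin m → Fin m → Fin K → ℤ)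
    (θ : Fin k → ℤ) (hθ : StrictMono θ) (t : Fin k → Equiv.Perm (Fin m) × (Fin m → Fin K))
    (hdom : ∀ r, IsDominant d v ε (θ r) (t r))
    (lstar : Fin K) (D : ℕ) (hD : ∀ l, l ≠ lstar → d l ≤ D) (hlex : (k / 2) * m * D ≤ d lstar)
    (c : ℕ) (hc : ∀ r, (univ.filter fun i => (t r).2 i = lstar).card = c) (hk : 0 < k)
    (r r' : Fin k) (i : Fin m) (hpos : (t r').1 i = (t r).1 i) :
    ((t r).2 i = lstar ↔ (t r').2 i = lstar) := by
  classical
  -- swap column `i` of `t r` for the entry of `t r'`: same rows, so a bijective selection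
  let sel : Fin m → Fin k := Function.update (fun _ => r) i r'
  have hrow : (fun j => (t (sel j)).1 j) = fun j => (t r).1 j := by
    funext j
    by_cases hj : j = i
    · subst hj; simp [sel, hpos]
    · simp [sel, Function.update_of_ne hj]
  have hbij : Function.Bijective fun j => (t (sel j)).1 j := by
    rw [hrow]; exact (t r).1.bijective
  have hcsel := classCount_eq_of_recombination d v ε θ hθ t hdom lstar D hD hlex c hc hk sel hbij
  -- the two filters agree off `i`
  set A := univ.filter fun j => (t r).2 j = lstar with hA
  set B := univ.filter fun j => (t (sel j)).2 j = lstar with hB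
  have hAB : A.erase i = B.erase i := by
    ext j
    simp only [mem_erase, hA, hB, mem_filter, mem_univ, true_and]
    constructor
    · rintro ⟨hj, h⟩; exact ⟨hj, by simpa [sel, Function.update_of_ne hj] using h⟩
    · rintro ⟨hj, h⟩; exact ⟨hj, by simpa [sel, Function.update_of_ne hj] using h⟩
  have hcard : A.card = B.card := by rw [hc r, hcsel]
  have hiB : i ∈ B ↔ (t r').2 i = lstar := by simp [hB, sel]
  have hiA : i ∈ A ↔ (t r).2 i = lstar := by simp [hA]
  rw [← hiA, ← hiB]
  constructor
  · intro hi
    by_contra hni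
    have h1 := card_erase_of_mem hi
    have h2 : (B.erase i).card = B.card := by rw [erase_eq_of_notMem hni]
    rw [hAB] at h1
    have : 0 < A.card := card_pos.mpr ⟨i, hi⟩
    omega
  · intro hi
    by_contra hni
    have h1 := card_erase_of_mem hi
    have h2 : (A.erase i).card = A.card := by rw [erase_eq_of_notMem hni]
    rw [← hAB] at h1
    have : 0 < B.card := card_pos.mpr ⟨i, hi⟩
    omega

/-- **GRADED PAGES.**  If the exponent of the class `l⋆` is at least `(k/2)·m` times every other exponent and `t₀, …, t_{k−1}` (`k ≥ 1`) are
dominant at strictly increasing slopes with the same `l⋆`-count `c`, then the `l⋆`-indicator on the positions used by the `t`'s is an integer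
row + column potential: `[ (t r).2 i = l⋆ ] = α ((t r).1 i) + β i` for all `r, i`. -/
theorem exists_grading {k : ℕ} (d : Fin K → ℕ) (v ε : Fin m → Fin m → Fin K → ℤ)
    (θ : Fin k → ℤ) (hθ : StrictMono θ) (t : Fin k → Equiv.Perm (Fin m) × (Fin m → Fin K))
    (hdom : ∀ r, IsDominant d v ε (θ r) (t r))
    (lstar : Fin K) (D : ℕ) (hD : ∀ l, l ≠ lstar → d l ≤ D) (hlex : (k / 2) * m * D ≤ d lstar)
    (c : ℕ) (hc : ∀ r, (univ.filter fun i => (t r).2 i = lstar).card = c) (hk : 0 < k) :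
    ∃ α β : Fin m → ℤ, ∀ (r : Fin k) (i : Fin m),
      (if (t r).2 i = lstar then (1 : ℤ) else 0) = α ((t r).1 i) + β i := by
  classical
  -- the union support and the top indicator of a position
  let P : Fin m → Fin m → Prop := fun a i => ∃ r, (t r).1 i = a
  let w : Fin m → Fin m → ℤ := fun a i => if ∃ r, (t r).1 i = a ∧ (t r).2 i = lstar then 1 else 0
  -- the indicator seen through any term using the position
  have hw : ∀ (r : Fin k) (i : Fin m), w ((t r).1 i) i = if (t r).2 i = lstar then 1 else 0 := by
    intro r i
    simp only [w]
    by_cases h : (t r).2 i = lstar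
    · rw [if_pos ⟨r, rfl, h⟩, if_pos h]
    · rw [if_neg, if_neg h]
      rintro ⟨r', hr', h'⟩
      exact h ((top_iff_of_same_position d v ε θ hθ t hdom lstar D hD hlex c hc hk r r' i hr').mpr h')
  -- constancy of `w` on supported permutations
  have hconstc : ∀ σ : Equiv.Perm (Fin m), (∀ i, P (σ i) i) → ∑ i, w (σ i) i = c := by
    intro σ hσ
    choose sel hsel using hσ
    have hbij : Function.Bijective fun j => (t (sel j)).1 j := by
      have : (fun j => (t (sel j)).1 j) = σ := funext hsel
      rw [this]; exact σ.bijective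
    have hcsel := classCount_eq_of_recombination d v ε θ hθ t hdom lstar D hD hlex c hc hk sel hbij
    have h1 : ∀ i, w (σ i) i = if (t (sel i)).2 i = lstar then 1 else 0 := by
      intro i; rw [← hsel i]; exact hw (sel i) i
    simp_rw [h1]
    rw [← hcsel, sum_boole]
  let r₀ : Fin k := ⟨0, hk⟩
  have hσ₀ : ∀ i, P ((t r₀).1 i) i := fun i => ⟨r₀, rfl⟩
  have hconst : ∀ σ : Equiv.Perm (Fin m), (∀ i, P (σ i) i) → ∑ i, w (σ i) i = ∑ i, w ((t r₀).1 i) i := by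
    intro σ hσ; rw [hconstc σ hσ, hconstc _ hσ₀]
  obtain ⟨α, β, h⟩ := BirkhoffFace.exists_potential_of_sum_const P w (t r₀).1 hσ₀ hconst
  refine ⟨α, β, fun r i => ?_⟩
  rw [← hw r i]
  exact h (t r).1 (fun j => ⟨r, rfl⟩) i

/-- On the union support the grading takes only the values `0` and `1`. -/
theorem grading_mem_zero_one {k : ℕ} (t : Fin k → Equiv.Perm (Fin m) × (Fin m → Fin K)) (lstar : Fin K) (α β : Fin m → ℤ)
    (h : ∀ (r : Fin k) (i : Fin m), (if (t r).2 i = lstar then (1 : ℤ) else 0) = α ((t r).1 i) + β i)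
    (r : Fin k) (i : Fin m) : α ((t r).1 i) + β i = 0 ∨ α ((t r).1 i) + β i = 1 := by
  rw [← h r i]
  by_cases hh : (t r).2 i = lstar
  · right; rw [if_pos hh]
  · left; rw [if_neg hh]

/-- **The page count through the grading.**  For every permutation `σ` supported in the union support of the page (each column uses a
position of some page term), the number of positions of `σ` that are top for the term through them is `Σ α + Σ β` — the same for all such
`σ` (telescoping form of page rigidity). -/
theorem card_top_eq_sum_grading {k : ℕ} (t : Fin k → Equiv.Perm (Fin m) × (Fin m → Fin K)) (lstar : Fin K) (α β : Fin m → ℤ)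
    (h : ∀ (r : Fin k) (i : Fin m), (if (t r).2 i = lstar then (1 : ℤ) else 0) = α ((t r).1 i) + β i)
    (σ : Equiv.Perm (Fin m)) (sel : Fin m → Fin k) (hsel : ∀ i, (t (sel i)).1 i = σ i) :
    ((univ.filter fun i => (t (sel i)).2 i = lstar).card : ℤ) = ∑ i, α i + ∑ i, β i := by
  classical
  rw [← Equiv.sum_comp σ α, ← sum_add_distrib]
  have : ∀ i, α (σ i) + β i = if (t (sel i)).2 i = lstar then 1 else 0 := by
    intro i; rw [← hsel i, ← h (sel i) i]
  simp_rw [this, sum_boole]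

end GradedPages

end Summit.ValiantsHypothesis.ValiantsHypothesis.Theorems.KPlusLogSqLaw
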